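import Literature.Geometry.Symplectic.AdaptedFrameBlockRotation
import Literature.Analysis.Matrix.NegativeEigenvectorSmooth
import Literature.Analysis.Calculus.SpaceCurveFraming
import Literature.Analysis.Calculus.ParametricLinearInverse
import Mathlib.Topology.Order.IntermediateValue
import HarnessLib

/-!
# The smooth block-adapted frame along an even zero circle (model level)

Topic `Geometry/Symplectic`; namespace `Literature.Geometry.Symplectic`.  Theorems only; no
named fact, no `sorry`.  Input: a `C^∞`, `P`-periodic family `J(θ) : ℝ⁴ →L Λ²(ℝ⁴)*` of
gradients of rank `3` with definite image (sign `s`), constant kernel vector `e₀`, SYMMETRIC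
Perutz form `P_θ(p, q) = J(θ)(p)(e₀, q)` (closedness), and a continuous `P`-periodic family
`w(θ)` of minority vectors of `P_θ` (evenness of the zero circle).  Output
(`exists_contDiff_blockFrame`): `C^∞`, `P`-periodic frames `A(θ) ∈ GL(ℝ⁴)` with `A(θ) e₀ = e₀`,
a sign `σ = ±1` and `C^∞`, `P`-periodic symmetric `3 × 3` matrices `M(θ)` in block form
`S⁺(θ) ⊕ S⁻(θ)` (last row/column `(0, 0, λ(θ))`, `λ(θ) < 0`, upper block positive definite) with
`J(θ)(A W)(A U, A V) = σ Σ_k (M(θ) W_N)_k β_k(U, V)` — the smooth form of step 1 of the proof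
of Perutz 2006, Lemma 3.1 ("`ω(t, x) = x · S(t) β + O(|x|²)`, `S(t) = S⁺(t) ⊕ S⁻(t)`"), with the
metric replaced by the self-dual-type frame and the eigenframe of `L⁻`.  Assembly of
`AdaptedFrameFamily` (smooth adapted frame), `AdaptedFramePerutzForm` (the matrix, symmetry,
minority transfer), `SignatureTwoOneOfMinority` + `NegativeEigenvectorSmooth` (smooth negative
eigenvector), `SpaceCurveFraming` (smooth orthonormal completion) and
`AdaptedFrameBlockRotation` (rotating the frame).

## References

* T. Perutz, *Zero-sets of near-symplectic forms*, J. Symplectic Geom. 4 (2006), §2.3 (c)–(d),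
  Prop. 2.2 and §3 (proof of Lemma 3.1, step 1). [Perutz2006]
-/

noncomputable section

open Set Function Module Matrix Literature.Geometry.Kaehler Literature.Topology.FourManifolds
  Literature.Analysis.Matrix Literature.Analysis.Calculus
open scoped Matrix ContDiff

namespace Literature.Geometry.Symplectic

/-- `ker J = ℝ e₀` by rank–nullity, for a rank-`3` map on `ℝ⁴` killing `e₀`. [folklore] -/
theorem exists_smul_stdVec_of_apply_eq_zero
    {G : EuclideanSpace ℝ (Fin 4) →L[ℝ] ((EuclideanSpace ℝ (Fin 4)) [⋀^Fin 2]→L[ℝ] ℝ)}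
    (hrank : Module.finrank ℝ (LinearMap.range G.toLinearMap) = 3) (hG0 : G (stdVec 0) = 0)
    {u : EuclideanSpace ℝ (Fin 4)} (hu : G u = 0) : ∃ b : ℝ, b • stdVec 0 = u := by
  have he0 : (stdVec 0 : EuclideanSpace ℝ (Fin 4)) ≠ 0 := by
    intro h; have := congrArg (· 0) h; simp [stdVec] at this
  have hker1 : Module.finrank ℝ (LinearMap.ker G.toLinearMap) = 1 := by
    have hrn := LinearMap.finrank_range_add_finrank_ker G.toLinearMap
    rw [hrank, finrank_euclideanSpace_fin] at hrn
    omega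
  have hτk : (⟨stdVec 0, LinearMap.mem_ker.2 hG0⟩ : LinearMap.ker G.toLinearMap) ≠ 0 :=
    fun h0 ↦ he0 (congrArg Subtype.val h0)
  obtain ⟨b, hb⟩ := (finrank_eq_one_iff_of_nonzero' _ hτk).1 hker1 ⟨u, LinearMap.mem_ker.2 hu⟩
  exact ⟨b, congrArg Subtype.val hb⟩

/-- A non-vanishing continuous real function on `ℝ` has constant sign: there is `σ = ±1` with
`σ q(θ) < 0` for all `θ`. [folklore] -/
theorem exists_sign_mul_neg {q : ℝ → ℝ} (hq : Continuous q) (h0 : ∀ θ, q θ ≠ 0) :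
    ∃ σ : ℝ, (σ = 1 ∨ σ = -1) ∧ ∀ θ, σ * q θ < 0 := by
  by_cases hq0 : q 0 < 0
  · refine ⟨1, Or.inl rfl, fun θ ↦ ?_⟩
    rw [one_mul]
    by_contra hθ
    have hθ' : 0 < q θ := lt_of_le_of_ne (not_lt.1 hθ) (h0 θ).symm
    obtain ⟨ξ, hξ⟩ := intermediate_value_univ 0 θ hq ⟨hq0.le, hθ'.le⟩
    exact h0 ξ hξ
  · have hq0' : 0 < q 0 := lt_of_le_of_ne (not_lt.1 hq0) (h0 0).symm
    refine ⟨-1, Or.inr rfl, fun θ ↦ ?_⟩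
    rw [neg_one_mul, neg_lt_zero]
    by_contra hθ
    have hθ' : q θ < 0 := lt_of_le_of_ne (not_lt.1 hθ) (h0 θ)
    obtain ⟨ξ, hξ⟩ := intermediate_value_univ θ 0 hq ⟨hθ'.le, hq0'.le⟩
    exact h0 ξ hξ

/-- A family of automorphisms with smooth columns applied to a smooth family of vectors is
smooth. [folklore] -/
theorem contDiff_equiv_apply
    {A : ℝ → (EuclideanSpace ℝ (Fin 4) ≃L[ℝ] EuclideanSpace ℝ (Fin 4))}
    (hA : ∀ u, ContDiff ℝ ∞ fun θ ↦ A θ u) {v : ℝ → EuclideanSpace ℝ (Fin 4)}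
    (hv : ContDiff ℝ ∞ v) : ContDiff ℝ ∞ fun θ ↦ A θ (v θ) := by
  have h : (fun θ ↦ A θ (v θ)) = fun θ ↦ ∑ i, v θ i • A θ (stdVec i) := by
    funext θ
    conv_lhs => rw [eq_sum_smul_stdVec (v θ)]
    simp only [map_sum, map_smul]
  rw [h]
  exact ContDiff.sum fun i _ ↦ (contDiff_euclidean.1 hv i).smul (hA _)

/-- A lift with smooth components is smooth. [folklore] -/
theorem contDiff_normalLift {a : ℝ → Fin 3 → ℝ} (ha : ContDiff ℝ ∞ a) :
    ContDiff ℝ ∞ fun θ ↦ normalLift (a θ) := by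
  unfold normalLift
  exact ContDiff.sum fun k _ ↦ (contDiff_pi.1 ha k).smul contDiff_const

/-- **The smooth block-adapted frame of an even zero circle (model level).**  See the module
docstring. [cite: Perutz2006, §3 (proof of Lemma 3.1, step 1) with §2.3 (d) and Prop. 2.2] -/
theorem exists_contDiff_blockFrame
    {J : ℝ → (EuclideanSpace ℝ (Fin 4) →L[ℝ] ((EuclideanSpace ℝ (Fin 4)) [⋀^Fin 2]→L[ℝ] ℝ))}
    (hJ : ∀ W, ContDiff ℝ ∞ fun θ ↦ J θ W) {s : ℝ} (hs : s = 1 ∨ s = -1)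
    (hrank : ∀ θ, Module.finrank ℝ (LinearMap.range (J θ).toLinearMap) = 3)
    (hdef : ∀ θ W, J θ W ≠ 0 → 0 < s * pfaffian (J θ W)) (hJ0 : ∀ θ, J θ (stdVec 0) = 0)
    (hsym : ∀ θ p q, J θ p ![stdVec 0, q] = J θ q ![stdVec 0, p])
    {w : ℝ → EuclideanSpace ℝ (Fin 4)} (hw : Continuous w)
    (hmin : ∀ θ, IsMinorityVector (fun v u ↦ J θ v ![stdVec 0, u]) (w θ))
    {P : ℝ} (hJP : ∀ θ, J (θ + P) = J θ) (hwP : ∀ θ, w (θ + P) = w θ) :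
    ∃ (A : ℝ → (EuclideanSpace ℝ (Fin 4) ≃L[ℝ] EuclideanSpace ℝ (Fin 4))) (σ : ℝ)
      (M : ℝ → Matrix (Fin 3) (Fin 3) ℝ),
      (∀ u, ContDiff ℝ ∞ fun θ ↦ A θ u) ∧ (∀ i j, ContDiff ℝ ∞ fun θ ↦ M θ i j) ∧
      (σ = 1 ∨ σ = -1) ∧ (∀ θ, A θ (stdVec 0) = stdVec 0) ∧ (∀ θ, (M θ).IsSymm) ∧
      (∀ θ (m : Fin 3), M θ m 2 = if m = 2 then M θ 2 2 else 0) ∧ (∀ θ, M θ 2 2 < 0) ∧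
      (∀ θ (v : Fin 3 → ℝ), v 2 = 0 → v ≠ 0 → 0 < v ⬝ᵥ M θ *ᵥ v) ∧
      (∀ θ W U V, J θ (A θ W) ![A θ U, A θ V] =
          σ * ∑ k, (M θ *ᵥ normalPart W) k * hondaBetaVec U V k) ∧
      (∀ θ, A (θ + P) = A θ) ∧ (∀ θ, M (θ + P) = M θ) := by
  have hs0 : s ≠ 0 := by rcases hs with rfl | rfl <;> norm_num
  -- (1) the smooth adapted frame
  obtain ⟨A, c, η, hAs, hcs, hηs, hc0, hA0, hW, -, h1, h2, h3, hexp, hper⟩ :=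
    exists_contDiff_adaptedFrame hJ hs hrank hdef hJ0
  have hvec : ∀ θ k u v, η k θ ![A θ u, A θ v] = c θ * hondaBetaVec u v k := fun θ ↦
    frame_relation_vec (h1 θ) (h2 θ) (h3 θ)
  have hperP := hper P hJP
  -- (2) Perutz's matrix, pointwise
  set Tm : ℝ → Matrix (Fin 3) (Fin 3) ℝ := fun θ ↦ perutzMatrix (J θ) (A θ) (fun k ↦ η k θ) s
    with hTm
  have hTsym : ∀ θ, (Tm θ).IsSymm := fun θ ↦
    perutzMatrix_isSymm (hvec θ) (hexp θ) (hA0 θ) (hJ0 θ) (hc0 θ) (hsym θ)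
  have hker : ∀ θ u, J θ u = 0 → ∃ b : ℝ, b • stdVec 0 = u := fun θ u hu ↦
    exists_smul_stdVec_of_apply_eq_zero (hrank θ) (hJ0 θ) hu
  have hnd : ∀ θ v, Tm θ *ᵥ v = 0 → v = 0 := fun θ v hv ↦
    perutzMatrix_mulVec_eq_zero (hexp θ) (hA0 θ) (hJ0 θ) (hker θ) hv
  have hTs : ∀ i j, ContDiff ℝ ∞ fun θ ↦ Tm θ i j := fun i j ↦
    contDiff_frameCoefficient hJ hAs (hηs i) s (stdVec j.succ)
  -- (3) the seed: the minority field in the frame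
  set n : ℝ → Fin 3 → ℝ := fun θ ↦ normalPart ((A θ).symm (w θ)) with hn
  have hnc : Continuous n := by
    have hc : Continuous fun θ ↦ (A θ).symm (w θ) :=
      continuous_symm_apply (fun i ↦ (hAs _).continuous) hw
    exact continuous_pi fun k ↦ (EuclideanSpace.proj k.succ).continuous.comp hc
  have hm : ∀ θ, n θ ⬝ᵥ (c θ • Tm θ) *ᵥ n θ ≠ 0 ∧ ∀ v : Fin 3 → ℝ,
      (n θ ⬝ᵥ (c θ • Tm θ) *ᵥ n θ) * (v ⬝ᵥ (c θ • Tm θ) *ᵥ v) ≤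
        (n θ ⬝ᵥ (c θ • Tm θ) *ᵥ v) ^ 2 := fun θ ↦
    minority_perutzMatrix (hvec θ) (hexp θ) (hA0 θ) (hJ0 θ) (hTsym θ) (hmin θ)
  -- (4) the constant sign `σ`
  set q : ℝ → ℝ := fun θ ↦ n θ ⬝ᵥ (c θ • Tm θ) *ᵥ n θ with hq
  have hqc : Continuous q := by
    change Continuous fun θ ↦ ∑ i, n θ i * ∑ j, (c θ • Tm θ) i j * n θ j
    refine continuous_finsetSum _ fun i _ ↦ ((continuous_apply i).comp hnc).mul ?_
    refine continuous_finsetSum _ fun j _ ↦ Continuous.mul ?_ ((continuous_apply j).comp hnc)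
    exact hcs.continuous.mul (hTs i j).continuous
  obtain ⟨σ, hσ, hσq⟩ := exists_sign_mul_neg hqc fun θ ↦ (hm θ).1
  have hσ2 : σ * σ = 1 := by rcases hσ with rfl | rfl <;> norm_num
  have hσ0 : σ ≠ 0 := by rcases hσ with rfl | rfl <;> norm_num
  -- (5) the signature-(2,1) family `T̂ = σ c T` with its negative seed
  set Th : ℝ → Matrix (Fin 3) (Fin 3) ℝ := fun θ ↦ σ • (c θ • Tm θ) with hTh
  have hThe : ∀ θ a b, a ⬝ᵥ Th θ *ᵥ b = σ * (a ⬝ᵥ (c θ • Tm θ) *ᵥ b) := fun θ a b ↦ by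
    simp only [hTh, smul_mulVec, dotProduct_smul, smul_eq_mul]
  have hThs : ∀ i j, ContDiff ℝ ∞ fun θ ↦ Th θ i j := fun i j ↦ by
    change ContDiff ℝ ∞ fun θ ↦ σ * (c θ * Tm θ i j)
    exact contDiff_const.mul (hcs.mul (hTs i j))
  have hThsym : ∀ θ, (Th θ).IsSymm := fun θ ↦ ((hTsym θ).smul _).smul _
  have hnneg : ∀ θ, n θ ⬝ᵥ Th θ *ᵥ n θ < 0 := fun θ ↦ by rw [hThe]; exact hσq θ
  have hsig : ∀ θ, ∃ (m : Fin 3 → ℝ) (lam : ℝ), m ⬝ᵥ m = 1 ∧ Th θ *ᵥ m = lam • m ∧ lam < 0 ∧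
      ∀ v, v ⬝ᵥ m = 0 → v ≠ 0 → 0 < v ⬝ᵥ Th θ *ᵥ v := by
    intro θ
    refine exists_negative_eigenvector_of_minority (hThsym θ) (fun v hv ↦ hnd θ v ?_) (hnneg θ)
      fun v ↦ ?_
    · simp only [hTh, smul_mulVec] at hv
      have h := congrArg (fun x ↦ (c θ)⁻¹ • σ • x) hv
      simp only [smul_zero, smul_smul] at h
      have hcoef : (c θ)⁻¹ * (σ * (σ * c θ)) = 1 := by
        rw [← mul_assoc σ σ, hσ2, one_mul, inv_mul_cancel₀ (hc0 θ)]
      rwa [hcoef, one_smul] at h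
    · rw [hThe, hThe, hThe]
      have h := mul_le_mul_of_nonneg_left ((hm θ).2 v) (mul_self_nonneg σ)
      calc σ * (n θ ⬝ᵥ (c θ • Tm θ) *ᵥ n θ) * (σ * (v ⬝ᵥ (c θ • Tm θ) *ᵥ v))
          = σ * σ * ((n θ ⬝ᵥ (c θ • Tm θ) *ᵥ n θ) * (v ⬝ᵥ (c θ • Tm θ) *ᵥ v)) := by ring
        _ ≤ σ * σ * (n θ ⬝ᵥ (c θ • Tm θ) *ᵥ v) ^ 2 := h
        _ = (σ * (n θ ⬝ᵥ (c θ • Tm θ) *ᵥ v)) ^ 2 := by ring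
  -- (6) the smooth negative eigenvector and its orthonormal completion
  obtain ⟨N, Λ, hNs, -, hN1, hTN, hΛ, -, hpos, hperN⟩ :=
    exists_contDiff_signed_negative_eigenvector hThs hThsym hsig hnc hnneg
  have hN0 : ∀ θ, N θ ≠ 0 := fun θ h0 ↦ by
    have := hN1 θ; rw [h0, zero_dotProduct] at this; exact zero_ne_one this
  obtain ⟨f, hfs, horth, hf2, hcross, hperf⟩ := exists_contDiff_orthonormal_frame hNs hN0
  have hf2' : ∀ θ, f 2 θ = N θ := fun θ ↦ by
    rw [hf2 θ, hN1 θ, Real.sqrt_one, inv_one, one_smul]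
  have horthθ : ∀ θ (i j : Fin 3), (fun m ↦ f m θ) i ⬝ᵥ (fun m ↦ f m θ) j =
      if i = j then 1 else 0 := fun θ i j ↦ horth θ i j
  -- (7) the rotated frame and the block matrix
  set A' : ℝ → (EuclideanSpace ℝ (Fin 4) ≃L[ℝ] EuclideanSpace ℝ (Fin 4)) := fun θ ↦
    rotateFrame (A θ) (fun m ↦ f m θ) (horthθ θ) with hA'
  set Tm' : ℝ → Matrix (Fin 3) (Fin 3) ℝ := fun θ ↦
    perutzMatrix (J θ) (A' θ) (rotateTriple (fun m ↦ f m θ) fun k ↦ η k θ) s with hTm'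
  set M : ℝ → Matrix (Fin 3) (Fin 3) ℝ := fun θ ↦ σ • (c θ • Tm' θ) with hM
  have hA'apply : ∀ θ u, A' θ u = A θ (rotateNormal (fun m ↦ f m θ) u) := fun θ u ↦ rfl
  have hTm'e : ∀ θ i j, Tm' θ i j = f i θ ⬝ᵥ Tm θ *ᵥ f j θ := fun θ i j ↦
    perutzMatrix_rotate (horthθ θ) (hA0 θ) (hJ0 θ) i j
  have hMe : ∀ θ i j, M θ i j = σ * (c θ * (f i θ ⬝ᵥ Tm θ *ᵥ f j θ)) := fun θ i j ↦ by
    simp only [hM, Matrix.smul_apply, smul_eq_mul, hTm'e]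
  -- eigenvector relation for the scaled matrix `(σ c) • Tm`
  have hf2T : ∀ θ, ((σ * c θ) • Tm θ) *ᵥ f 2 θ = Λ θ • f 2 θ := fun θ ↦ by
    rw [hf2', ← hTN θ]
    simp only [hTh, smul_smul]
  have hposT : ∀ θ x, x ⬝ᵥ f 2 θ = 0 → x ≠ 0 → 0 < x ⬝ᵥ ((σ * c θ) • Tm θ) *ᵥ x := by
    intro θ x hx hx0
    have h := hpos θ x (by rw [← hf2']; exact hx) hx0
    simpa only [hTh, smul_smul] using h
  refine ⟨A', σ, M, ?_, ?_, hσ, fun θ ↦ rotateFrame_stdVec_zero (horthθ θ) (hA0 θ), ?_, ?_, ?_,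
    ?_, ?_, ?_, ?_⟩
  · -- smooth columns of `A'`
    intro u
    have h : (fun θ ↦ A' θ u) = fun θ ↦
        u 0 • A θ (stdVec 0) + ∑ m, u m.succ • A θ (normalLift (f m θ)) := by
      funext θ
      rw [hA'apply, rotateNormal_apply, map_add, map_smul, map_sum]
      simp only [map_smul]
    rw [h]
    refine ContDiff.add ?_ ?_
    · exact (contDiff_const (c := u 0)).smul (hAs (stdVec 0))
    · exact ContDiff.sum fun m _ ↦ (contDiff_const (c := u m.succ)).smul
        (contDiff_equiv_apply hAs (contDiff_normalLift (hfs m)))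
  · -- smooth entries of `M`
    intro i j
    have h : (fun θ ↦ M θ i j) = fun θ ↦
        σ * (c θ * ∑ a, f i θ a * ∑ b, Tm θ a b * f j θ b) := by
      funext θ; rw [hMe]; rfl
    rw [h]
    refine contDiff_const.mul (hcs.mul (ContDiff.sum fun a _ ↦ ?_))
    refine (contDiff_pi.1 (hfs i) a).mul (ContDiff.sum fun b _ ↦ ?_)
    exact (hTs a b).mul (contDiff_pi.1 (hfs j) b)
  · -- symmetry
    intro θ
    exact ((perutzMatrix_rotate_isSymm (horthθ θ) (hA0 θ) (hJ0 θ) (hTsym θ)).smul _).smul _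
  · -- block form of the last column
    intro θ m
    have hcol := perutzMatrix_rotate_col (horthθ θ) (hA0 θ) (hJ0 θ) (hf2T θ)
    have hMm : ∀ m', M θ m' 2 = σ * c θ * Tm' θ m' 2 := fun m' ↦ by
      simp only [hM, Matrix.smul_apply, smul_eq_mul, mul_assoc]
    rw [hMm, hMm, hcol m, hcol 2, if_pos rfl]
  · -- `M₂₂ = λ < 0`
    intro θ
    have hcol := perutzMatrix_rotate_col (horthθ θ) (hA0 θ) (hJ0 θ) (hf2T θ) 2
    rw [if_pos rfl] at hcol
    have hM22 : M θ 2 2 = σ * c θ * Tm' θ 2 2 := by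
      simp only [hM, Matrix.smul_apply, smul_eq_mul, mul_assoc]
    rw [hM22, hcol]
    exact hΛ θ
  · -- positivity of the upper block
    intro θ v hv2 hv0
    have h := perutzMatrix_rotate_pos (horthθ θ) (hA0 θ) (hJ0 θ) (hposT θ) hv2 hv0
    have hMeq : M θ = (σ * c θ) • Tm' θ := by simp only [hM, smul_smul]
    rw [hMeq]
    exact h
  · -- the gradient identity
    intro θ W U V
    rw [gradient_rotate (horthθ θ) (hcross θ) (hvec θ) (hW θ) (hexp θ) (hA0 θ) (hJ0 θ) W U V,
      Finset.mul_sum, Finset.mul_sum]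
    refine Finset.sum_congr rfl fun k _ ↦ ?_
    have hMv : (M θ *ᵥ normalPart W) k = σ * (c θ * (Tm' θ *ᵥ normalPart W) k) := by
      simp only [hM, smul_mulVec, Pi.smul_apply, smul_eq_mul]
    rw [hMv]
    calc c θ * ((Tm' θ *ᵥ normalPart W) k * hondaBetaVec U V k)
        = σ * σ * (c θ * ((Tm' θ *ᵥ normalPart W) k * hondaBetaVec U V k)) := by
          rw [hσ2, one_mul]
      _ = σ * (σ * (c θ * (Tm' θ *ᵥ normalPart W) k) * hondaBetaVec U V k) := by ring
  · -- periodicity of `A'`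
    intro θ
    have hThP : ∀ θ, Th (θ + P) = Th θ := fun θ ↦ by
      simp only [hTh, hTm, (hperP θ).2.1]
      congr 2
      ext i j
      simp only [perutzMatrix_apply, perutzCoeff_apply, hJP, (hperP θ).1, (hperP θ).2.2]
    have hnP : ∀ θ, n (θ + P) = n θ := fun θ ↦ by simp only [hn, (hperP θ).1, hwP]
    have hNP : ∀ θ, N (θ + P) = N θ := fun θ ↦ (hperN P hThP hnP θ).1
    have hfP : ∀ m θ, f m (θ + P) = f m θ := fun m θ ↦ hperf P hNP m θ
    refine ContinuousLinearEquiv.ext (funext fun u ↦ ?_)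
    rw [hA'apply, hA'apply, (hperP θ).1]
    simp only [hfP]
  · -- periodicity of `M`
    intro θ
    have hThP : ∀ θ, Th (θ + P) = Th θ := fun θ ↦ by
      simp only [hTh, hTm, (hperP θ).2.1]
      congr 2
      ext i j
      simp only [perutzMatrix_apply, perutzCoeff_apply, hJP, (hperP θ).1, (hperP θ).2.2]
    have hnP : ∀ θ, n (θ + P) = n θ := fun θ ↦ by simp only [hn, (hperP θ).1, hwP]
    have hNP : ∀ θ, N (θ + P) = N θ := fun θ ↦ (hperN P hThP hnP θ).1
    have hfP : ∀ m θ, f m (θ + P) = f m θ := fun m θ ↦ hperf P hNP m θ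
    have hTmP : Tm (θ + P) = Tm θ := by
      ext i j
      simp only [hTm, perutzMatrix_apply, perutzCoeff_apply, hJP, (hperP θ).1, (hperP θ).2.2]
    ext i j
    rw [hMe, hMe, (hperP θ).2.1, hfP, hfP, hTmP]

end Literature.Geometry.Symplectic

end
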